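import Literature.AlgebraicGeometry.Motives.UniversalHypersurfaceRegularLocusChartCoeff
import Literature.AlgebraicGeometry.Motives.UniversalHypersurfaceRegularLocusChartFunction
import HarnessLib

/-!
# Submersivity of `(b, ρ)` on `𝒴°(ℂ)` read in a chart: a criterion in the coordinates `(b', y)`

Family `hodge`, layer `Literature/AlgebraicGeometry/Motives`; sequel of `UniversalHypersurfaceRegularLocusChartCoeff` (on `𝒴°(ℂ)ᵢ` the coefficient
vector is `regChartCoeffVec ∘ regChartFun`) and `UniversalHypersurfaceRegularLocusChartFunction` (functions `regChartExtend B` of the chart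
coordinates extended by zero). The tangent-lift lemma `Geometry/Manifold/SubmersionLiftVectorField` (`exists_contMDiff_lift_vectorField_tangent`)
asks, on a closed set `K`, for the differential of the pair `(g, ρ) = ((b_m)_m, ρ)` to be onto. Here that condition is reduced to Euclidean
calculus in the chart coordinates:

* `mfderiv_pair_eq_fderiv_comp` — for `Q ∈ 𝒴°(ℂ)ᵢ`, the differential of `Q ↦ (b(Q), regChartExtend B Q)` at `Q` is
  `D[v ↦ (regChartCoeffVec v, B v)](Φᵢ Q) ∘ dΦᵢ(Q)`;
* `surjective_mfderiv_pair_of_surjective_fderiv` — **hence it is onto as soon as `D[v ↦ (regChartCoeffVec v, B v)](Φᵢ Q)` is onto**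
  (`dΦᵢ(Q)` is bijective, `bijective_mfderiv_regChartFun`).

Everything is proved; no definitions, no named facts.

## References

* [BrockerJanichIDT1982] T. Bröcker, K. Jänich, Introduction to Differential Topology (1982), §5 (submersions in charts).
* [SerreGAGA1956] J.-P. Serre, Géométrie algébrique et géométrie analytique, Ann. Inst. Fourier 6 (1956), §2 n°5–6.
-/

noncomputable section

open CategoryTheory AlgebraicGeometry TopologicalSpace Set Topology Filter
open scoped Manifold ContDiff
open Literature.AlgebraicGeometry.HodgeTheory Literature.NumberTheory.Transcendental

namespace Literature.AlgebraicGeometry.Motives.UniversalHypersurface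

variable (n d : ℕ) (i : Fin (n + 2))

/-- On `𝒴°(ℂ)ᵢ`, `Q ↦ (b(Q), regChartExtend B Q)` is `(regChartCoeffVec, B) ∘ regChartFun`, eventually near each of its points.
[cite: BrockerJanichIDT1982, §5] -/
theorem pair_eventuallyEq_comp_regChartFun {F : Type*} [Zero F]
    (B : (({m : DegIndex n d // m ≠ regPowIndex n d i} ⊕ Fin (n + 1)) → ℂ) → F)
    {Q : ComplexPoints (regularTotal ℂ n d)} (hQ : Q ∈ regChartDom n d i) :
    (fun Q' => (regCoeff ℂ n d Q', regChartExtend n d i B Q')) =ᶠ[𝓝 Q]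
      (fun v => (regChartCoeffVec n d i v, B v)) ∘ regChartFun n d i := by
  filter_upwards [(isOpen_regChartDom n d i).mem_nhds hQ] with Q' hQ'
  simp only [Function.comp_apply, Prod.mk.injEq]
  exact ⟨regCoeff_eq_regChartCoeffVec n d i hQ', regChartExtend_of_mem n d i B hQ'⟩

/-- **The differential of `(b, ρ_B)` in the chart**: for `Q ∈ 𝒴°(ℂ)ᵢ` and `B` `C^∞`,
`d(b, ρ_B)(Q) = D(regChartCoeffVec, B)(Φᵢ Q) ∘ dΦᵢ(Q)`. [cite: BrockerJanichIDT1982, §5] -/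
theorem mfderiv_pair_eq_fderiv_comp (hd : 0 < d) {F : Type*} [NormedAddCommGroup F] [NormedSpace ℝ F]
    (B : (({m : DegIndex n d // m ≠ regPowIndex n d i} ⊕ Fin (n + 1)) → ℂ) → F) (hB : ContDiff ℝ ∞ B)
    {Q : ComplexPoints (regularTotal ℂ n d)} (hQ : Q ∈ regChartDom n d i) :
    haveI := locallyOfFiniteType_regularTotal_hom ℂ n d hd
    haveI := smoothOfRelativeDimension_regularTotal_hom ℂ n d hd
    letI := ComplexPoints.chartedSpace (regularTotal ℂ n d) (n + Fintype.card (DegIndex n d))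
    mfderiv (𝓡 (2 * (n + Fintype.card (DegIndex n d)))) 𝓘(ℝ, (DegIndex n d → ℂ) × F)
        (fun Q' => (regCoeff ℂ n d Q', regChartExtend n d i B Q')) Q =
      (fderiv ℝ (fun v => (regChartCoeffVec n d i v, B v)) (regChartFun n d i Q)).comp
        (mfderiv (𝓡 (2 * (n + Fintype.card (DegIndex n d))))
          𝓘(ℝ, ({m : DegIndex n d // m ≠ regPowIndex n d i} ⊕ Fin (n + 1)) → ℂ) (regChartFun n d i) Q) := by
  haveI := locallyOfFiniteType_regularTotal_hom ℂ n d hd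
  haveI := smoothOfRelativeDimension_regularTotal_hom ℂ n d hd
  letI := ComplexPoints.chartedSpace (regularTotal ℂ n d) (n + Fintype.card (DegIndex n d))
  haveI := ComplexPoints.isManifold_real (regularTotal ℂ n d) (n + Fintype.card (DegIndex n d))
  have hE : ContDiff ℝ ∞ (fun v : ({m : DegIndex n d // m ≠ regPowIndex n d i} ⊕ Fin (n + 1)) → ℂ =>
      (regChartCoeffVec n d i v, B v)) := (contDiff_regChartCoeffVec n d i).prodMk hB
  have hEd : MDifferentiableAt 𝓘(ℝ, ({m : DegIndex n d // m ≠ regPowIndex n d i} ⊕ Fin (n + 1)) → ℂ)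
      𝓘(ℝ, (DegIndex n d → ℂ) × F) (fun v => (regChartCoeffVec n d i v, B v)) (regChartFun n d i Q) :=
    ((hE.differentiable (by simp)).differentiableAt).mdifferentiableAt
  have hΦ : MDifferentiableAt (𝓡 (2 * (n + Fintype.card (DegIndex n d))))
      𝓘(ℝ, ({m : DegIndex n d // m ≠ regPowIndex n d i} ⊕ Fin (n + 1)) → ℂ) (regChartFun n d i) Q :=
    (contMDiffAt_regChartFun n d i hd hQ).mdifferentiableAt (by simp)
  rw [(pair_eventuallyEq_comp_regChartFun n d i B hQ).mfderiv_eq, mfderiv_comp Q hEd hΦ, mfderiv_eq_fderiv]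
  exact ContinuousLinearMap.ext fun v => rfl

/-- **Criterion for the joint submersion in the chart**: if `D[v ↦ (regChartCoeffVec v, B v)](Φᵢ Q)` is onto then so is the manifold
differential of `Q ↦ (b(Q), regChartExtend B Q)` at `Q ∈ 𝒴°(ℂ)ᵢ` (`dΦᵢ(Q)` is bijective). [cite: BrockerJanichIDT1982, §5] -/
theorem surjective_mfderiv_pair_of_surjective_fderiv (hd : 0 < d) {F : Type*} [NormedAddCommGroup F] [NormedSpace ℝ F]
    (B : (({m : DegIndex n d // m ≠ regPowIndex n d i} ⊕ Fin (n + 1)) → ℂ) → F) (hB : ContDiff ℝ ∞ B)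
    {Q : ComplexPoints (regularTotal ℂ n d)} (hQ : Q ∈ regChartDom n d i)
    (hsurj : Function.Surjective (fderiv ℝ (fun v => (regChartCoeffVec n d i v, B v)) (regChartFun n d i Q))) :
    haveI := locallyOfFiniteType_regularTotal_hom ℂ n d hd
    haveI := smoothOfRelativeDimension_regularTotal_hom ℂ n d hd
    letI := ComplexPoints.chartedSpace (regularTotal ℂ n d) (n + Fintype.card (DegIndex n d))
    Function.Surjective (mfderiv (𝓡 (2 * (n + Fintype.card (DegIndex n d)))) 𝓘(ℝ, (DegIndex n d → ℂ) × F)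
      (fun Q' => (regCoeff ℂ n d Q', regChartExtend n d i B Q')) Q) := by
  haveI := locallyOfFiniteType_regularTotal_hom ℂ n d hd
  haveI := smoothOfRelativeDimension_regularTotal_hom ℂ n d hd
  letI := ComplexPoints.chartedSpace (regularTotal ℂ n d) (n + Fintype.card (DegIndex n d))
  have hΦbij : Function.Bijective (mfderiv (𝓡 (2 * (n + Fintype.card (DegIndex n d))))
      𝓘(ℝ, ({m : DegIndex n d // m ≠ regPowIndex n d i} ⊕ Fin (n + 1)) → ℂ) (regChartFun n d i) Q) :=
    bijective_mfderiv_regChartFun n d i hd hQ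
  rw [mfderiv_pair_eq_fderiv_comp n d i hd B hB hQ]
  have key : Function.Surjective
      (⇑(fderiv ℝ (fun v => (regChartCoeffVec n d i v, B v)) (regChartFun n d i Q)) ∘
        ⇑(mfderiv (𝓡 (2 * (n + Fintype.card (DegIndex n d))))
          𝓘(ℝ, ({m : DegIndex n d // m ≠ regPowIndex n d i} ⊕ Fin (n + 1)) → ℂ) (regChartFun n d i) Q)) :=
    hsurj.comp hΦbij.2
  exact key

end Literature.AlgebraicGeometry.Motives.UniversalHypersurface

end
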